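import Summits.QuantumFields.BalabanUV.T4Continuum.Support.NE7PinnedLandauRepDual
import Summits.QuantumFields.BalabanUV.T4Continuum.Support.NE7ApeCurvedRepSameTopCritical
import Summits.QuantumFields.BalabanUV.T4Continuum.Support.NE7TopMismatchLetters
import HarnessLib

/-!
# NE7ApeCurvedRepPinnedDual — (APE) WITH A DATUM AT A TANGENT-CRITICAL BACKGROUND, THE PINNED REPRESENTATIVE LANDAU AGAINST THE `s`-TRANSLATED (DUAL) CLASS, PRODUCED
# MODULO THE TRANSLATED LHCI: F78 ∘ F93 — (APE) with a datum ⇐ LHCI_s(W) + (L1)′ + α₁ + (L2), the (L1)∕gradient quantifiers over PINNED-TOP representatives Landau against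
# the translated class; for `s = ⌊M∕2⌋·𝟙` this is the numerically well-conditioned (corner-centred) version of F92; file 28

Cell `pub-balaban`, rung (B)+1 sub-cell t4, lineage `b2b-balaban-t4-ne7-p1` (CRUX PROVER NE7 #1 = OWNER of row NE7), generation 77; memo
`t4/b2b-balaban-t4-ne7-p1-g77/GAUGED-TOP-TT.md` §9∕§10.  File F94 (over F78 `NE7ApeCurvedRepSameTopCritical.smallField_of_tanCritical_repSameTop_critBackground`, F93
`NE7PinnedLandauRepDual.exists_pinnedLandauRepTransl_of_lhci`, F74 `NE7TopMismatchLetters.cavgIter_gaugeAct_eq_of_pinned`).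
WHY (memo §4∕§7∕§10).  F92 docked the cornered class, whose corner interpolation is ill-conditioned (corners on block boundaries); the translated class with `s = ⌊M∕2⌋·𝟙`
puts the corners at the block CENTRES (flat numerics: `C_I` M- and N-uniform).  THIS FILE is F92 verbatim with the test class translated by an arbitrary `s`.
WHAT ([folklore]; 0 def, 0 sorry).  **`smallField_of_tanCritical_pinnedRepTransl_of_lhci`** — F78's conclusion from: F78's background∕field hypotheses, `cavgIter U = cavgIter W`,
the initial gauge `r₀`, `b₀`, row NE3's class data of `W`, the translated LHCI of `W` by shape, E′'s regime at the PG constants, `2r̄ ≤ α₀`, and (L1)′, `α₁`, (L2) on `S` —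
(L1)′ and the gradient member quantified over skew periodic `Z` Landau against the translated class with `‖Z‖ ≤ α₀` and `cavgIter (We^{Z}) = cavgIter W`.
HONEST FRAMING (page 1): composition; the LHCI, (L1)′, `α₁`, (L2) are HYPOTHESES; nothing of Bałaban's asserted; (APE) on curved data NOT proved; NOT ONE-STEP, NOT NE7;
spine 0∕9; finite T⁴ rung (B)+1 — NOT infinite volume, NOT mass gap, NOT `BetaPertH`, NOT Clay.  Continuum YM on T⁴ ⇐ BetaPertH ∧ nine spine estimates (0/9 proved);
BetaPertH ⇐ (D1) ∧ (D4) ∧ CAP+tail; G-an2-4 gates asym, D1 and NE2/3/4.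
-/

set_option autoImplicit false

open scoped BigOperators Matrix Matrix.Norms.L2Operator
open NormedSpace Finset Set

namespace Summit.QuantumFields.BalabanUV.T4Continuum.NE7ApeCurvedRepPinnedDual

open Literature.MathematicalPhysics.QuantumFieldTheory.Balaban1983to89
open B7Prop1Explicit B7Prop2Explicit MatrixLog UnitaryModel
open T4AveragingDeficitWall (Ad IsUnitaryCfg IsSkewDir SmallField vary curlAt dirL1)
open T4AveragingDeficitWallBoundary (IsPeriodicCfg periodBox)
open AveragingDeficitPeriodicCounting (IsPeriodicDir)
open AveragingDeficitTwoLevelPrep (twoLevelSmall)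
open AveragingDeficitMultiLevelPrep (cavgIter LevelSmall)
open MinimalActionLevels (perWin)
open BlockAverageVaryHolo (nbRad)
open BlockAveragePushDirGauge (gaugeDir)
open NE3HessForm (hess dAction)
open NE3TangentCovariantTower (dirIter)
open NE3EnergyShapes (IsUnitarySite IsPeriodicSite)
open NE3CovariantWeitzenbock (covDiv)
open NE3CovariantCalculus (hsR)
open NE3RightInverseSupLetters (frameC)
open NE3QbarIterCovLiftPrep (cruxC)
open NE3RightInverseSolveLetters (thetaLoc)
open NE3HatInvCurlLetters (curl1C)
open NE3.PairLandauB8 (covLapSite avgKernelGauges)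
open NE7ApeCurvedRepSameTopCritical (smallField_of_tanCritical_repSameTop_critBackground)
open NE7PinnedLandauRepDual (exists_pinnedLandauRepTransl_of_lhci)
open NE7TopMismatchLetters (cavgIter_gaugeAct_eq_of_pinned)

noncomputable section

variable {d : ℕ} {n : Type*} [Fintype n] [DecidableEq n]

/-- **(APE) WITH A DATUM AT A TANGENT-CRITICAL BACKGROUND, PINNED REPRESENTATIVE LANDAU AGAINST THE TRANSLATED CLASS, PRODUCED MODULO THE TRANSLATED LHCI**
(statement in the module docstring). [folklore] -/
theorem smallField_of_tanCritical_pinnedRepTransl_of_lhci [Nonempty n] (hd : 2 ≤ d) {L N : ℕ} [NeZero N] (hL : 2 ≤ L) (j : ℕ) (s : Site d)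
    -- the background
    {W : Site d → Fin d → (Matrix n n ℂ)ˣ} {x : ℝ} (hWu : IsUnitaryCfg W) (hWP : IsPeriodicCfg W ((N * L ^ (j + 1) : ℕ) : ℤ))
    (hx : 0 ≤ x) (hs : LevelSmall d L j x) (hWx : SmallField W x)
    -- the sup radius of the representative and the regime at `x′ = x + 4(e^{α₀} − 1)`
    {α₀ : ℝ} (hα0 : 0 ≤ α₀) (hs' : LevelSmall d L j (x + 4 * (Real.exp α₀ - 1)))
    (hθ : cruxC d L * (((L : ℝ) ^ (j + 1)) ^ 2 * (x + 4 * (Real.exp α₀ - 1))) < 1)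
    (hθl : thetaLoc d L * (((L : ℝ) ^ (j + 1)) ^ 2 * (x + 4 * (Real.exp α₀ - 1))) < 1)
    (hε : ((L : ℝ) ^ (j + 1)) ^ 2 * (x + 4 * (Real.exp α₀ - 1)) ≤ 1)
    -- the field: of the class, tangent-critical
    {U : Site d → Fin d → (Matrix n n ℂ)ˣ} (hUu : IsUnitaryCfg U) (hUP : IsPeriodicCfg U ((N * L ^ (j + 1) : ℕ) : ℤ))
    {xU : ℝ} (hxU : 0 ≤ xU) (hsU : LevelSmall d L j xU) (hUxU : SmallField U xU)
    (hcritU : ∀ Y : Site d → Fin d → Matrix n n ℂ, IsSkewDir Y → IsPeriodicDir Y ((N * L ^ (j + 1) : ℕ) : ℤ) →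
      dirIter L (j + 1) U Y = 0 → dAction U Y (perWin d (N * L ^ (j + 1))) = 0)
    -- NEW: the field lies over `W`'s datum; its initial (−1)∕(−2) gauge relative to `W`
    (hTopUW : cavgIter L (j + 1) U = cavgIter L (j + 1) W)
    {r₀ b₀ : ℝ} (hr₀ : ∀ (y : Site d) (μ : Fin d), ‖(((W y μ)⁻¹ * U y μ : (Matrix n n ℂ)ˣ) : (Matrix n n ℂ)) - 1‖ ≤ r₀)
    (hb₀ : ∀ x : Site d, ‖covDiv W (fun y μ => mlog (((W y μ)⁻¹ * U y μ : (Matrix n n ℂ)ˣ) : (Matrix n n ℂ))) x‖ ≤ b₀)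
    -- row NE3's class data of `W` (plaquette-gradient radius, E′'s radius lines)
    {x₁ : ℝ} (hx10 : 0 ≤ x₁)
    (hgrad : ∀ (p : Site d) (μ κ : Fin d), κ ≠ μ →
      ‖Ad (W p μ) ((hol W (p + e μ) (plaqWord κ μ) : (Matrix n n ℂ)ˣ) : Matrix n n ℂ) - ((hol W p (plaqWord κ μ) : (Matrix n n ℂ)ˣ) : Matrix n n ℂ)‖ ≤ x₁)
    (hbx : 23040 * (d : ℝ) ^ 4 * (frameC d L + d) ^ 2 * ((L : ℝ) ^ (j + 1)) ^ 2 * x ≤ 1)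
    (hcx : 11520 * (d : ℝ) ^ 4 * (frameC d L + d) ^ 3 * ((L : ℝ) ^ (j + 1)) ^ 3 * x₁ ≤ 1)
    -- the LHCI of `W` by shape (memo §5∕§8): existence with the Laplacian bound, uniqueness
    {CI : ℝ} (hCI : 0 ≤ CI)
    (hI : ∀ a : Site d → Matrix n n ℂ, (∀ w, a w ∈ skewAdjoint (Matrix n n ℂ)) → (∀ (w : Site d) (i : Fin d), a (w + (N : ℤ) • e i) = a w) →
      ∃ eta : Site d → Matrix n n ℂ,
        (∀ y, eta y ∈ skewAdjoint (Matrix n n ℂ)) ∧ (∀ (y : Site d) (i : Fin d), eta (y + ((N * L ^ (j + 1) : ℕ) : ℤ) • e i) = eta y) ∧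
        (∀ w : Site d, eta ((((L ^ (j + 1) : ℕ) : ℤ)) • w) = a w) ∧
        (∀ nu : Site d → Matrix n n ℂ, (∀ y, nu y ∈ skewAdjoint (Matrix n n ℂ)) →
            (∀ (y : Site d) (i : Fin d), nu (y + ((N * L ^ (j + 1) : ℕ) : ℤ) • e i) = nu y) →
            (fun y => nu (y - s)) ∈ avgKernelGauges (d := d) (n := n) L N (j + 1) (fun y μ => W (y - s) μ) →
          ∑ y ∈ periodBox (d := d) (N * L ^ (j + 1)), ∑ κ : Fin d, hsR (gaugeDir W eta y κ) (gaugeDir W (covLapSite W nu) y κ) = 0) ∧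
        ∀ A : ℝ, (∀ w, ‖a w‖ ≤ A) → ∀ y, ‖covLapSite W eta y‖ ≤ CI / ((L : ℝ) ^ (j + 1)) ^ 2 * A)
    (hIu : ∀ mu : Site d → Matrix n n ℂ, (∀ y, mu y ∈ skewAdjoint (Matrix n n ℂ)) →
      (∀ (y : Site d) (i : Fin d), mu (y + ((N * L ^ (j + 1) : ℕ) : ℤ) • e i) = mu y) → (∀ w : Site d, mu ((((L ^ (j + 1) : ℕ) : ℤ)) • w) = 0) →
      (∀ nu : Site d → Matrix n n ℂ, (∀ y, nu y ∈ skewAdjoint (Matrix n n ℂ)) →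
          (∀ (y : Site d) (i : Fin d), nu (y + ((N * L ^ (j + 1) : ℕ) : ℤ) • e i) = nu y) →
          (fun y => nu (y - s)) ∈ avgKernelGauges (d := d) (n := n) L N (j + 1) (fun y μ => W (y - s) μ) →
        ∑ y ∈ periodBox (d := d) (N * L ^ (j + 1)), hsR (covLapSite W mu y) (covLapSite W nu y) = 0) →
      ∀ y, covLapSite W mu y = 0)
    -- the constants (F83's `c₀`, `c₁`; E′'s `c_R`; the PG `c_R`), named; E′'s regime at these constants; the sup radius `α₀ ≥ 2r̄`
    {c₀ c₁ cR cRE : ℝ} (hc₁ : c₁ = 36 * d * (d : ℝ)) (hc₀ : c₀ = 36 * d * (d : ℝ) ^ 2)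
    (hcRE : cRE = 1 + 2 * (Fintype.card n : ℝ) * (64 * (d : ℝ) ^ 2 * N) ^ d + 27 * (Fintype.card n : ℝ) ^ 3 * (512 : ℝ) ^ d * (N : ℝ) ^ d)
    (hcR : cR = cRE * (1 + CI * (36 * d * (frameC d L + d) ^ 2)))
    (hreg₁ : c₀ * ((L : ℝ) ^ (j + 1)) ^ 2 * (cR * b₀) ≤ 1 / 10) (hreg₂ : c₁ * (L : ℝ) ^ (j + 1) * (cR * b₀) ≤ 1 / 25)
    (hreg₃ : r₀ + 5 / 2 * (c₁ * (L : ℝ) ^ (j + 1) * (cR * b₀)) ≤ 1 / 20)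
    (hline : cR * (4 * (c₀ * ((L : ℝ) ^ (j + 1)) ^ 2) * (b₀ + 4 * (cR * b₀))
        + 25 * d * (r₀ + 5 / 2 * (c₁ * (L : ℝ) ^ (j + 1) * (cR * b₀))) * (c₁ * (L : ℝ) ^ (j + 1))
        + 14 * d * (c₁ * (L : ℝ) ^ (j + 1)) ^ 2 * (cR * b₀)) ≤ 1 / 2)
    (hα₀ : 2 * (r₀ + 5 / 2 * (c₁ * (L : ℝ) ^ (j + 1) * (cR * b₀))) ≤ α₀)
    -- the remaining analytic letters at `W`: (L1) normal lift of `Z`, the gradient member, (L2) slice solver, (L3) tension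
    (S : Set (Site d → Fin d → Matrix n n ℂ)) {cN KG ν : ℝ} (hν : 0 ≤ ν)
    -- (L1) the normal lift and the gradient member, for every PINNED-TOP `Z` of sup radius `α₀` Landau against the translated class
    (hNlift : ∀ Z : Site d → Fin d → Matrix n n ℂ, IsSkewDir Z → IsPeriodicDir Z ((N * L ^ (j + 1) : ℕ) : ℤ) →
      (∀ nu : Site d → Matrix n n ℂ, (∀ y, nu y ∈ skewAdjoint (Matrix n n ℂ)) →
          (∀ (y : Site d) (i : Fin d), nu (y + ((N * L ^ (j + 1) : ℕ) : ℤ) • e i) = nu y) →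
          (fun y => nu (y - s)) ∈ avgKernelGauges (d := d) (n := n) L N (j + 1) (fun y μ => W (y - s) μ) →
        ∑ y ∈ periodBox (d := d) (N * L ^ (j + 1)), ∑ κ : Fin d, hsR (Z y κ) (gaugeDir W (covLapSite W nu) y κ) = 0) →
      (∀ y μ, ‖Z y μ‖ ≤ α₀) → cavgIter L (j + 1) (vary W Z 1) = cavgIter L (j + 1) W →
      ∃ AN : Site d → Fin d → Matrix n n ℂ, IsPeriodicDir AN ((N * L ^ (j + 1) : ℕ) : ℤ) ∧
        dirIter L (j + 1) W AN = dirIter L (j + 1) W Z ∧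
        (∀ z μ' ν', μ' ≠ ν' → ‖curlAt W AN z μ' ν'‖ ≤ cN) ∧
        (∀ Y : Site d → Fin d → Matrix n n ℂ, IsSkewDir Y → IsPeriodicDir Y ((N * L ^ (j + 1) : ℕ) : ℤ) → dirIter L (j + 1) W Y = 0 →
          |hess W AN Y (perWin d (N * L ^ (j + 1)))| ≤ ν * dirL1 Y (periodBox (d := d) (N * L ^ (j + 1)))) ∧
        (fun y μ => Z y μ - AN y μ) ∈ S)
    {α₁ : ℝ} (hα1 : 0 ≤ α₁)
    (hGrad : ∀ Z : Site d → Fin d → Matrix n n ℂ, IsSkewDir Z → IsPeriodicDir Z ((N * L ^ (j + 1) : ℕ) : ℤ) →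
      (∀ nu : Site d → Matrix n n ℂ, (∀ y, nu y ∈ skewAdjoint (Matrix n n ℂ)) →
          (∀ (y : Site d) (i : Fin d), nu (y + ((N * L ^ (j + 1) : ℕ) : ℤ) • e i) = nu y) →
          (fun y => nu (y - s)) ∈ avgKernelGauges (d := d) (n := n) L N (j + 1) (fun y μ => W (y - s) μ) →
        ∑ y ∈ periodBox (d := d) (N * L ^ (j + 1)), ∑ κ : Fin d, hsR (Z y κ) (gaugeDir W (covLapSite W nu) y κ) = 0) →
      (∀ y μ, ‖Z y μ‖ ≤ α₀) → cavgIter L (j + 1) (vary W Z 1) = cavgIter L (j + 1) W →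
      ∀ (y : Site d) (κ τ : Fin d), ‖Ad (W (y + e κ) τ) (Z (y + e τ) κ) - Z y κ‖ ≤ α₁)
    (hG : ∀ X ∈ S, IsPeriodicDir X ((N * L ^ (j + 1) : ℕ) : ℤ) → dirIter L (j + 1) W X = 0 → ∀ g : ℝ, 0 ≤ g →
      (∀ Y : Site d → Fin d → Matrix n n ℂ, IsSkewDir Y → IsPeriodicDir Y ((N * L ^ (j + 1) : ℕ) : ℤ) → dirIter L (j + 1) W Y = 0 →
        |hess W X Y (perWin d (N * L ^ (j + 1)))| ≤ g * dirL1 Y (periodBox (d := d) (N * L ^ (j + 1)))) →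
      ∀ z μ' ν', μ' ≠ ν' → ‖curlAt W X z μ' ν'‖ ≤ KG * g)
    -- (L3) DISCHARGED: the background is tangent-critical
    (hcritW : ∀ Y : Site d → Fin d → Matrix n n ℂ, IsSkewDir Y → IsPeriodicDir Y ((N * L ^ (j + 1) : ℕ) : ℤ) → dirIter L (j + 1) W Y = 0 →
      dAction W Y (perWin d (N * L ^ (j + 1))) = 0) :
    SmallField U (x + (KG * (
        ((x + 4 * (Real.exp α₀ - 1))
            * ((curl1C d L / (1 - thetaLoc d L * (((L : ℝ) ^ (j + 1)) ^ 2 * (x + 4 * (Real.exp α₀ - 1)))))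
                * (((L : ℝ) ^ (j + 1)) ^ d / ((L : ℝ) ^ (j + 1)) ^ 2))
            * (Real.exp (((L : ℝ) ^ d / L) * ((d : ℝ) * (16 * ((d : ℝ) + 1) * ((d : ℝ) + 4) * (L : ℝ) ^ 2)
                  * (1250 * ((nbRad d L : ℝ) + L) + 8 * ((d : ℝ) * L) + 2 * L)) * (2 / twoLevelSmall d L))
                * ((L : ℝ) / (L : ℝ) ^ d) ^ j
                * (((d : ℝ) * (2 * nbRad d L + 1) ^ d) * ((2 * (d : ℝ) + 4) * (L : ℝ) ^ 2) * (2 * (L : ℝ) ^ j) * (Real.exp α₀ - 1)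
                  + (17 / 8 * ((L : ℝ) ^ 2) ^ j * (x + 4 * (Real.exp α₀ - 1)))
                    * (((d : ℝ) * (2 * nbRad d L + 1) ^ d) * ((2 * (d : ℝ) + 4)
                          * (2 * (2 * L * (nbRad d L : ℝ) + 128 * ((d : ℝ) + 1) * ((d : ℝ) + 4) * (L : ℝ) ^ 2)))
                      + ((d : ℝ) * (2 * nbRad d L + 1) ^ d) * ((2 * (d : ℝ) + 4) * (L : ℝ) ^ 2 * (2 * (nbRad d L : ℝ))
                          + 2 * (8 * (L : ℝ) + (1250 * ((nbRad d L : ℝ) + L) + 8 * (d * L) + 2 * L))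
                              * (16 * ((d : ℝ) + 1) * ((d : ℝ) + 4) * (L : ℝ) ^ 2))))))
        + (Fintype.card (T4AveragingDeficitWall.Plane d) : ℝ)
          * (2 * (240 * (Real.exp α₀ - 1) * α₀ * (2 * α₁ + 24 * α₀ * (Real.exp α₀ - 1) + x) + 8 * α₀ * (2 * α₁ + 24 * α₀ * (Real.exp α₀ - 1))
              + 6 * (Real.exp α₀ - 1) * (2 * α₁ + 24 * (Real.exp α₀ - 1) * α₀)
              + (2 * α₁ + 24 * (Real.exp α₀ - 1) * α₀) * (2 * α₁ + 24 * α₀ * (Real.exp α₀ - 1))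
              + 960 * (Real.exp α₀ - 1) * α₀ ^ 2 + 32 * x * α₀ ^ 2)
            + (64 * α₀ * α₁ + 1024 * x * α₀ ^ 2))
        + ν) + cN + 28 * α₀ ^ 2)) := by
  have hd1 : 1 ≤ d := by omega
  have hL1 : 1 ≤ L := by omega
  -- F93: the pinned representative Landau against the translated class, modulo the translated LHCI
  obtain ⟨u, Z, huU, huP, hZs, hZP, hrep, hu0, hLan, -, hZsup, -, -⟩ :=
    exists_pinnedLandauRepTransl_of_lhci hd1 hL j s hWu hWP hx hs hWx hx10 hgrad hbx hcx hCI hI hIu hc₁ hc₀ hcRE hcR hUu hUP hr₀ hb₀ hreg₁ hreg₂ hreg₃ hline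
  have hZα : ∀ y μ, ‖Z y μ‖ ≤ α₀ := fun y μ => (hZsup y μ).trans hα₀
  -- the pinned gauge keeps the top: `cavgIter (We^{Z}) = cavgIter (U^u) = cavgIter U = cavgIter W`
  have hpin : ∀ z : Site d, u (((L : ℤ) ^ (j + 1)) • z) = 1 := fun z => by
    have h := hu0 z
    push_cast at h
    exact h
  have hTopZ : cavgIter L (j + 1) (vary W Z 1) = cavgIter L (j + 1) W := by
    rw [← hrep]
    exact cavgIter_gaugeAct_eq_of_pinned hL1 j hUu hxU hsU hUxU hTopUW huU hpin
  -- the (L1) letters at this representative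
  obtain ⟨AN, hNP, hNexact, hN7, hNorth, hTS⟩ := hNlift Z hZs hZP hLan hZα hTopZ
  have hZ1 := hGrad Z hZs hZP hLan hZα hTopZ
  exact smallField_of_tanCritical_repSameTop_critBackground hd hL j hWu hWP hx hs hWx hα0 hs' hθ hθl hε hUu hxU hsU hUxU hcritU huU huP hZs hZP hrep hZα hTopZ
    S hν hNP hNexact hN7 hNorth hTS hα1 hZ1 hG hcritW

end

end Summit.QuantumFields.BalabanUV.T4Continuum.NE7ApeCurvedRepPinnedDual
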